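import Summits.CriticalPhenomena.CardyFormulaZ2.Theorems.CardyMagicRigidityNestingRigidityNeckZ2ErrorCoverChain
import Summits.CriticalPhenomena.CardyFormulaZ2.Theorems.CardyMagicRigidityNestingRigidityNeckZ2NodeCounting
import Summits.CriticalPhenomena.CardyFormulaZ2.Theorems.CardyMagicRigidityNestingRigidityNeckZ2StrandsRSW
import HarnessLib

/-!
# Crux `NestingRigidity`, line `pinch-resampling` (v4), stub S12: the `𝔅`-error is a GATED four-arm event — re-cut of `ZNodeAbsBoundB`

Crux `Summit.CriticalPhenomena.CardyFormulaZ2.Theses.CardyMagicRigidity.NestingRigidity`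
(stmt-CriticalPhenomena-4835), line `pinch-resampling` v4, stub S12 `stub_neckHookupCoarseZ2 : NeckHookupCoarseZ2`.
Wave 6, worker W6b, target `ZNodeAbsBoundB` (`…NeckZ2ErrorCover`: smallness of the node event `ZNodeEventB` of the
error part `𝔅 = ZHookR ∖ ZHookBig`, "the small inner-touching blobs are jointly pivotal for the hook-up").

**Finding (why the target is re-cut and not summed).**  `ZNodeEventB` carries (i) the NODE clause — honest four arms
`fourArmTwoClustersAt w r R` across every annulus whose `lam`-thickening is free of the family `F` — and (ii) the
touching-NECKLACE clause.  (i) is vacuous for families `2 lam`-dense along a whole side of the inner layer (every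
admissible annulus meets another member or exceeds `R ≤ s - 1`), so (ii) must pay for dense runs; the only cost of a
dense run certified by the tree's inputs (RSW, `QuadCrossing.fourArm_bound`) is an RSW constant `q < 1` per `lam`-block
(no clean open circuit), which cannot pay the `O(1)` nats of entropy per bead/window that EVERY hierarchy bookkeeping
(single-linkage over members, or "dense run = one node" over windows) charges at bounded ratios: families of many
short dense windows at bounded mutual ratios make the union bound diverge for all but explicit numerical values of
`q` and of the four-arm constant.  (For `𝔄`, `…NeckZ2NodeReimerSpatial`, the per-junction arm surplus `c₁ log L` pays
this; `𝔅` has no `L`-growing per-bead surplus.)  What (ii) DOES give, deterministically and at every scale, is proved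
here: around every member, in EVERY annulus (free or not), the two sides cross and are not joined inside the annulus
by an open path avoiding the small blobs of `F` — a four-arm event WITH GATES (§1–§2).  With it the `𝔅`-bound is the
`k = 1` union bound over a `lam`-net of the inner layer (§3), exactly as `real_exists_fourArm_innerLayer_le`, provided
the gated event obeys Garban's two-radius bound with exponent `> 1`: the single named statement `ZGatedFourArmBound`
(§3, NOT asserted; heuristically true with the honest exponent, since travelling along the inner layer through gates
costs a fixed factor `< 1` per `lam`-block, exponentially worse than honest dual arms; its proof is Garban's scheme
`FourArmGarban*` for the gated event and is NOT in the tree).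

* §1 `ZGatedFourArm lam s x w r R` — two open crossings of `zAnn w r R` avoiding the small collar blobs of some finite
  family of inner-layer vertices and not joined by an open path of the annulus avoiding them;
  `fourArmTwoClustersAt ⊆ ZGatedFourArm` (no gates).
* §2 `NeckCoarseZ2.zGatedFourArm_of_necklace` (deterministic): the necklace clause of `zCovering_B` puts `ω` in
  `ZGatedFourArm lam s x w r R` for every inner-layer centre `w`, member `c`, `|c - w|_∞ + lam + 1 ≤ r ≤ R ≤ s - 1`;
  hence `ZNodeEventB lam s x ⊆ ⋃_{w ∈ ilNet x s lam} ZGatedFourArm lam s x w (2 lam) (s - 1)` on lattice configurations.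
* §3 `ZGatedFourArmBound : Prop` (named, NOT asserted) and the reductions `zNodeAbsBoundB_of_gatedFourArmBound :
  ZGatedFourArmBound → ZNodeAbsBoundB` (registered anchor), `neckHookupCoarseZ2_of_chainA_gated :
  ZNodeAbsBoundChainA → ZGatedFourArmBound → NeckHookupCoarseZ2` (with `zFourStrandsPositive_holds`).
-/

noncomputable section

namespace Summit.CriticalPhenomena.CardyFormulaZ2.Cruxes.NestingRigidity.PinchResampling

open MeasureTheory Set Literature.Probability.Percolation Literature.Probability.LatticeModels
open ZPinchLocality
open NeckCoarseZ2

/-! ## §1 The gated four-arm event -/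

/-- **The gated four-arm event** around `w` at radii `r ≤ R`, for the collar of `Λ_s(x)` with bigness threshold `lam`:
for some finite family `F` of inner-layer vertices with SMALL collar blobs (sup diameter `< lam`, the gates), two open
crossings of the square annulus `zAnn w r R` inside `zAvoid s x ω F` (the big ball minus the blobs of `F`) whose starts
are not joined by an open path of `zAnn w r R ∩ zAvoid s x ω F`.  With `F = ∅` this is the tree's honest cluster-form
four-arm event (`fourArmTwoClustersAt_subset_zGatedFourArm`). -/
def ZGatedFourArm (lam s : ℕ) (x w : Site 2) (r R : ℕ) : Set (BondConfig (Site 2)) :=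
  {ω | ∃ F : Finset (Site 2), (∀ c ∈ F, c ∈ innerLayer (zdGraph 2) (zBall x s) (zBall x (2 * s)) ∧
      ¬ ∃ u ∈ blobOf (openGraph ω) (zBall x (2 * s) \ zBall x s) c,
        ∃ u' ∈ blobOf (openGraph ω) (zBall x (2 * s) \ zBall x s) c, (lam : ℤ) ≤ zNorm (u - u')) ∧
    ∃ p₁ q₁ p₂ q₂ : Site 2, zNorm (p₁ - w) = r ∧ zNorm (q₁ - w) = R ∧ zNorm (p₂ - w) = r ∧ zNorm (q₂ - w) = R ∧
      PathIn (openGraph ω) (zAnn w r R ∩ zAvoid s x ω ↑F) p₁ q₁ ∧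
      PathIn (openGraph ω) (zAnn w r R ∩ zAvoid s x ω ↑F) p₂ q₂ ∧
      ¬ PathIn (openGraph ω) (zAnn w r R ∩ zAvoid s x ω ↑F) p₁ p₂}

/-- With the empty family nothing is avoided: `zAvoid s x ω ∅ = Λ_{2s}(x)`. -/
theorem NeckCoarseZ2.zAvoid_empty (s : ℕ) (x : Site 2) (ω : BondConfig (Site 2)) :
    zAvoid s x ω ↑(∅ : Finset (Site 2)) = zBall x (2 * s) := by
  simp [zAvoid]

/-- **No gates**: the honest four-arm event around an inner-layer centre (radii `1 ≤ r ≤ R ≤ s - 1`) is gated. -/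
theorem fourArmTwoClustersAt_subset_zGatedFourArm {lam s : ℕ} {x w : Site 2} {r R : ℕ}
    (hw : w ∈ innerLayer (zdGraph 2) (zBall x s) (zBall x (2 * s))) (hr : 1 ≤ r) (hrR : r ≤ R) (hRs : R + 1 ≤ s) :
    fourArmTwoClustersAt w r R ⊆ ZGatedFourArm lam s x w r R := by
  intro ω hω
  obtain ⟨p₁, q₁, p₂, q₂, hp₁, hq₁, hp₂, hq₂, h₁, h₂, hn⟩ := crossings_of_mem_fourArmTwoClustersAt hr hrR hω
  have hsub : zAnn w r R ⊆ zAnn w r R ∩ zAvoid s x ω ↑(∅ : Finset (Site 2)) := fun z hz ↦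
    ⟨hz, by rw [NeckCoarseZ2.zAvoid_empty]; exact zAnn_subset_zBall hw hRs hz⟩
  refine ⟨∅, fun c hc ↦ (Finset.notMem_empty c hc).elim, p₁, q₁, p₂, q₂, hp₁, hq₁, hp₂, hq₂, h₁.mono hsub,
    h₂.mono hsub, fun h ↦ hn (h.mono inter_subset_left)⟩

/-! ## §2 The necklace clause gives the gated event in every annulus -/

namespace NeckCoarseZ2

variable {lam s : ℕ} {x : Site 2} {ω : BondConfig (Site 2)}

/-- Big blobs avoid the blobs of a family of small-blob vertices. -/
theorem mem_zAvoid_of_big {F : Finset (Site 2)}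
    (hF : ∀ c ∈ F, c ∈ innerLayer (zdGraph 2) (zBall x s) (zBall x (2 * s)) ∧
      ¬ ∃ u ∈ blobOf (openGraph ω) (zBall x (2 * s) \ zBall x s) c,
        ∃ u' ∈ blobOf (openGraph ω) (zBall x (2 * s) \ zBall x s) c, (lam : ℤ) ≤ zNorm (u - u'))
    {u z : Site 2}
    (hbig : ∃ w₁ ∈ blobOf (openGraph ω) (zBall x (2 * s) \ zBall x s) u,
      ∃ w₂ ∈ blobOf (openGraph ω) (zBall x (2 * s) \ zBall x s) u, (lam : ℤ) ≤ zNorm (w₁ - w₂))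
    (hz : z ∈ blobOf (openGraph ω) (zBall x (2 * s) \ zBall x s) u) : z ∈ zAvoid s x ω ↑F := by
  refine ⟨(PathIn.right_mem hz).1, fun hz' ↦ ?_⟩
  simp only [mem_iUnion, Finset.mem_coe, exists_prop] at hz'
  obtain ⟨c, hc, hzc⟩ := hz'
  have hcu : blobOf (openGraph ω) (zBall x (2 * s) \ zBall x s) c = blobOf (openGraph ω) (zBall x (2 * s) \ zBall x s) u :=
    (NeckCoarse.blobOf_eq_of_mem hzc).symm.trans (NeckCoarse.blobOf_eq_of_mem hz)
  refine (hF c hc).2 ?_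
  rw [hcu]; exact hbig

/-- **The gated four-arm event from the necklace clause (deterministic).**  On a lattice configuration with
`lam + 1 ≤ s`: a family `F` of inner-layer vertices with small blobs, two crossings `v, v'` not joined inside
`zAvoid s x ω F`, and a member `c ∈ F` whose blob is joined by open edges to a vertex `a₁` reachable from `v` and to a
vertex `a₂` reachable from `v'` inside `zAvoid s x ω F`, put `ω` in `ZGatedFourArm lam s x w r R` for every inner-layer
centre `w` and radii `|c - w|_∞ + lam + 1 ≤ r ≤ R`, `R + 1 ≤ s` (the two sides enter `Λ_{r-1}(w)` next to the blob of
`c`, leave `Λ_{R-1}(w)` through the crossing blobs, and are not joined inside the avoiding set). -/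
theorem zGatedFourArm_of_necklace (hHG : ∀ a b, (openGraph ω).Adj a b → (zdGraph 2).Adj a b) (hls : lam + 1 ≤ s)
    {F : Finset (Site 2)}
    (hF : ∀ c ∈ F, c ∈ innerLayer (zdGraph 2) (zBall x s) (zBall x (2 * s)) ∧
      ¬ ∃ u ∈ blobOf (openGraph ω) (zBall x (2 * s) \ zBall x s) c,
        ∃ u' ∈ blobOf (openGraph ω) (zBall x (2 * s) \ zBall x s) c, (lam : ℤ) ≤ zNorm (u - u'))
    {v v' : Site 2} (hv : IsCrossing (zdGraph 2) (openGraph ω) (zBall x s) (zBall x (2 * s)) v)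
    (hv' : IsCrossing (zdGraph 2) (openGraph ω) (zBall x s) (zBall x (2 * s)) v')
    (hFP : ¬ PathIn (openGraph ω) (zAvoid s x ω ↑F) v v') {c : Site 2} (hc : c ∈ F) {a₁ c₁ a₂ c₂ : Site 2}
    (hpa₁ : PathIn (openGraph ω) (zAvoid s x ω ↑F) v a₁) (hadj₁ : (openGraph ω).Adj a₁ c₁)
    (hc₁ : c₁ ∈ blobOf (openGraph ω) (zBall x (2 * s) \ zBall x s) c)
    (hpa₂ : PathIn (openGraph ω) (zAvoid s x ω ↑F) v' a₂) (hadj₂ : (openGraph ω).Adj a₂ c₂)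
    (hc₂ : c₂ ∈ blobOf (openGraph ω) (zBall x (2 * s) \ zBall x s) c)
    {w : Site 2} (hw : w ∈ innerLayer (zdGraph 2) (zBall x s) (zBall x (2 * s))) {r R : ℕ}
    (hr : zNorm (c - w) + lam + 1 ≤ r) (hrR : r ≤ R) (hRs : R + 1 ≤ s) : ω ∈ ZGatedFourArm lam s x w r R := by
  set K := zBall x s with hK
  set O := zBall x (2 * s) with hO
  set H := openGraph ω with hH'
  -- the two sides are not connected inside the avoiding set
  have hn12 : ¬ PathIn H (zAvoid s x ω ↑F) a₁ a₂ := fun h ↦ hFP ((hpa₁.trans h).trans hpa₂.symm)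
  -- near: the entry points lie inside `Λ_{r-1}(w)`
  have hnear : ∀ {a cc : Site 2}, H.Adj a cc → cc ∈ blobOf H (O \ K) c → zNorm (a - w) < r := by
    intro a cc hadj hcc
    have h1 : zNorm (a - cc) ≤ 1 := by
      have := zNorm_sub_le_of_adj (hHG _ _ hadj).symm cc
      have h0 : zNorm (cc - cc) = 0 := by simp [zNorm]
      omega
    have h2 := zNorm_sub_lt_of_small (hF c hc).2 hcc (NeckCoarse.self_mem_blobOf (hF c hc).1.1)
    have h4 := zNorm_sub_le_add a cc w
    have h5 := zNorm_sub_le_add cc c w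
    omega
  -- far: through the crossing blob to the outer layer
  have hfar : ∀ {c₀ a : Site 2}, IsCrossing (zdGraph 2) H K O c₀ → PathIn H (zAvoid s x ω ↑F) c₀ a →
      ∃ q, PathIn H (zAvoid s x ω ↑F) a q ∧ (R : ℤ) ≤ zNorm (q - w) := by
    intro c₀ a hc₀ hp
    obtain ⟨hbig, q, hq, hqo⟩ := big_and_crossing_of_isCrossing hls hc₀
    refine ⟨q, hp.symm.trans (openPathIn_of_forall_reach hq fun z hz ↦ mem_zAvoid_of_big hF hbig hz), ?_⟩
    have h1 := zNorm_eq_of_mem_outerLayer hqo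
    have h2 := zNorm_eq_of_mem_innerLayer hw
    have h3 := zNorm_sub_le_add q w x
    omega
  obtain ⟨q₁', ha₁q, hq₁R⟩ := hfar hv hpa₁
  obtain ⟨q₂', ha₂q, hq₂R⟩ := hfar hv' hpa₂
  obtain ⟨p₁, q₁, hp₁, hq₁, hcross₁, ha₁p₁⟩ := exists_zAnn_crossing_of_pathIn hHG hrR (hnear hadj₁ hc₁) hq₁R ha₁q
  obtain ⟨p₂, q₂, hp₂, hq₂, hcross₂, ha₂p₂⟩ := exists_zAnn_crossing_of_pathIn hHG hrR (hnear hadj₂ hc₂) hq₂R ha₂q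
  have hswap : zAvoid s x ω ↑F ∩ zAnn w r R ⊆ zAnn w r R ∩ zAvoid s x ω ↑F := fun z hz ↦ ⟨hz.2, hz.1⟩
  refine ⟨F, hF, p₁, q₁, p₂, q₂, hp₁, hq₁, hp₂, hq₂, hcross₁.mono hswap, hcross₂.mono hswap, fun h12 ↦ hn12 ?_⟩
  exact ha₁p₁.trans ((h12.mono inter_subset_right).trans ha₂p₂.symm)

/-- **`ZNodeEventB` is covered by the gated four-arm events around the `lam`-net of the inner layer** (lattice
configurations, `1 ≤ lam`, `2 lam + 2 ≤ s`): radii `2 lam ≤ s - 1`. -/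
theorem zNodeEventB_subset_iUnion_zGatedFourArm (hlam : 1 ≤ lam) (hs : 2 * lam + 2 ≤ s) :
    ZNodeEventB lam s x ∩ {ω | ω ⊆ (zdGraph 2).edgeSet} ⊆
      ⋃ w ∈ ilNet x s lam, ZGatedFourArm lam s x w (2 * lam) (s - 1) := by
  rintro ω ⟨⟨F, hF, ⟨c, hc⟩, ⟨v, v', hv, hv', hFP, htouch⟩, -⟩, hlat⟩
  have hHG : ∀ a b, (openGraph ω).Adj a b → (zdGraph 2).Adj a b := fun a b h ↦
    (SimpleGraph.mem_edgeSet _).1 (hlat ((openGraph_adj ω a b).1 h).1)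
  obtain ⟨a₁, c₁, a₂, c₂, hpa₁, hadj₁, hc₁, hpa₂, hadj₂, hc₂⟩ := htouch c hc
  obtain ⟨w, hw, hcw⟩ := exists_mem_ilNet_near x hlam (hF c hc).1
  have hwL : w ∈ innerLayer (zdGraph 2) (zBall x s) (zBall x (2 * s)) := ilNet_subset_innerLayer x (by omega) hw
  exact mem_biUnion hw (zGatedFourArm_of_necklace hHG (by omega) hF hv hv' hFP hc hpa₁ hadj₁ hc₁ hpa₂ hadj₂ hc₂ hwL
    (by omega) (by omega) (by omega))

end NeckCoarseZ2

/-! ## §3 The named gated four-arm bound and the reduction of `ZNodeAbsBoundB` -/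

/-- **Garban's two-radius four-arm bound for the GATED event** (a statement, NOT asserted; the re-cut `𝔅`-input of
stub S12): there are `C, ε > 0` such that for every centre `x`, radius `s`, bigness threshold `lam`, inner-layer
centre `w` and radii `lam + 1 ≤ r ≤ R`, `R + 1 ≤ s`, `P_{1/2}(ZGatedFourArm lam s x w r R) ≤ C (r/R)^{1+ε}`.  For
the empty family of gates this contains `QuadCrossing.fourArm_bound` on these annuli
(`fourArmTwoClustersAt_subset_zGatedFourArm`); the gates — small blobs hanging off the inner layer, across which the
separating dual arms may jump — are expected not to change the exponent (a run of jumps along the inner layer costs a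
fixed RSW factor `< 1` per `lam`-block), but no proof is in the tree. -/
def ZGatedFourArmBound : Prop :=
  ∃ C ε : ℝ, 0 < C ∧ 0 < ε ∧ ∀ (x w : Site 2) (lam s r R : ℕ),
    w ∈ innerLayer (zdGraph 2) (zBall x s) (zBall x (2 * s)) → lam + 1 ≤ r → r ≤ R → R + 1 ≤ s →
    (bondPercolation (zdGraph 2) half).real (ZGatedFourArm lam s x w r R) ≤ C * ((r : ℝ) / R) ^ (1 + ε)

/-- Arithmetic of the `k = 1` union bound: with `N · lam ≤ 3 s`, `2 ≤ s` and `ρ = 2 lam / (s - 1)`,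
`4 N · (C ρ^{1+ε}) ≤ 48 C ρ^ε`. -/
theorem NeckCoarseZ2.net_mul_rpow_le {C ε ρ : ℝ} {N lam s : ℝ} (hC : 0 ≤ C) (hlam : 0 < lam)
    (hs : 2 ≤ s) (hN : N * lam ≤ 3 * s) (hρ : ρ = 2 * lam / (s - 1)) :
    4 * N * (C * ρ ^ (1 + ε)) ≤ 48 * C * ρ ^ ε := by
  have hs1 : 0 < s - 1 := by linarith
  have hρ0 : 0 < ρ := by rw [hρ]; positivity
  have hsplit : ρ ^ (1 + ε) = ρ * ρ ^ ε := by rw [Real.rpow_add hρ0, Real.rpow_one]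
  have hA : 4 * N * ρ ≤ 48 := by
    rw [hρ, show 4 * N * (2 * lam / (s - 1)) = 8 * (N * lam) / (s - 1) by ring, div_le_iff₀ hs1]
    nlinarith
  calc 4 * N * (C * ρ ^ (1 + ε)) = (4 * N * ρ) * (C * ρ ^ ε) := by rw [hsplit]; ring
    _ ≤ 48 * (C * ρ ^ ε) := mul_le_mul_of_nonneg_right hA (by positivity)
    _ = 48 * C * ρ ^ ε := by ring

/-- **`ZNodeAbsBoundB` from the gated four-arm bound (registered helper, anchor of this module on the crux item)** —
the `k = 1` union bound: `ZNodeEventB ⊆ ⋃_{w ∈ ilNet x s lam} ZGatedFourArm lam s x w (2 lam) (s - 1)` off a null set,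
`|ilNet| ≤ 4 (2s/lam + 1)`, each term `≤ C (2 lam/(s-1))^{1+ε}`, total `≤ 48 C (4/L)^{ε} ≤ b` for `L · lam ≤ s`,
`L ≥ 4 (48 C / b)^{1/ε}`. -/
theorem zNodeAbsBoundB_of_gatedFourArmBound : ZGatedFourArmBound → ZNodeAbsBoundB := by
  rintro ⟨C, ε, hC, hε, hbd⟩ b hb
  -- the scale ratio
  set t : ℝ := (b / (48 * C)) ^ ε⁻¹ with ht
  have ht0 : 0 < t := Real.rpow_pos_of_pos (by positivity) _
  have htε : t ^ ε = b / (48 * C) := by rw [ht, Real.rpow_inv_rpow (by positivity) hε.ne']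
  refine ⟨max 4 (⌈4 / t⌉₊ + 1), fun x lam s hlam hLs ↦ ?_⟩
  set L : ℕ := max 4 (⌈4 / t⌉₊ + 1) with hL
  set μ := bondPercolation (zdGraph 2) half with hμ
  have hL4 : 4 ≤ L := le_max_left _ _
  have hLt : 4 / t < L := by
    have h1 : 4 / t ≤ ⌈4 / t⌉₊ := Nat.le_ceil _
    have h2 : ((⌈4 / t⌉₊ + 1 : ℕ) : ℝ) ≤ L := by exact_mod_cast le_max_right 4 (⌈4 / t⌉₊ + 1)
    push_cast at h2
    linarith
  have hs4 : 4 * lam ≤ s := le_trans (Nat.mul_le_mul_right lam hL4) hLs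
  have hs2 : 2 * lam + 2 ≤ s := by omega
  have h1s : 1 ≤ s := by omega
  -- discard the non-lattice configurations and cover by the net
  have hae : ∀ᵐ ω ∂μ, ω ⊆ (zdGraph 2).edgeSet := ae_subset_edgeSet (zdGraph 2) half
  have heq : μ.real (ZNodeEventB lam s x) = μ.real (ZNodeEventB lam s x ∩ {ω | ω ⊆ (zdGraph 2).edgeSet}) := by
    refine measureReal_congr (Filter.eventuallyEq_set.2 (hae.mono fun ω hω ↦ ?_))
    simp only [mem_inter_iff, mem_setOf_eq, hω, and_true]
  have hcover := NeckCoarseZ2.zNodeEventB_subset_iUnion_zGatedFourArm (x := x) hlam hs2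
  -- each term of the union bound
  have hterm : ∀ w ∈ ilNet x s lam, μ.real (ZGatedFourArm lam s x w (2 * lam) (s - 1)) ≤
      C * (((2 * lam : ℕ) : ℝ) / ((s - 1 : ℕ) : ℝ)) ^ (1 + ε) := fun w hw ↦
    hbd x w lam s (2 * lam) (s - 1) (ilNet_subset_innerLayer x h1s hw) (by omega) (by omega) (by omega)
  -- the arithmetic
  set ρ : ℝ := ((2 * lam : ℕ) : ℝ) / ((s - 1 : ℕ) : ℝ) with hρ
  have hρ' : ρ = 2 * (lam : ℝ) / ((s : ℝ) - 1) := by rw [hρ]; push_cast [Nat.cast_sub h1s]; ring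
  have hlamR : (0 : ℝ) < lam := by exact_mod_cast hlam
  have hsR : (2 : ℝ) ≤ s := by exact_mod_cast (show 2 ≤ s by omega)
  have hN : (((2 * s / lam + 1 : ℕ) : ℝ)) * lam ≤ 3 * s := by
    have h1 : (2 * s / lam + 1) * lam ≤ 3 * s := by
      have := Nat.div_mul_le_self (2 * s) lam
      have h2 : lam ≤ s := by omega
      rw [Nat.add_mul, one_mul]; omega
    exact_mod_cast h1
  have hs1 : (0 : ℝ) < s - 1 := by linarith
  have hρ0 : 0 ≤ ρ := by rw [hρ']; exact div_nonneg (by positivity) hs1.le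
  have hρε : ρ ^ ε ≤ b / (48 * C) := by
    rw [← htε]
    refine Real.rpow_le_rpow hρ0 ?_ hε.le
    -- `ρ ≤ 4 / L < t`
    have hLs' : (L : ℝ) * lam ≤ s := by exact_mod_cast hLs
    have hL0 : (0 : ℝ) < L := by exact_mod_cast (show 0 < L by omega)
    have hρL : ρ ≤ 4 / L := by
      rw [hρ', div_le_div_iff₀ hs1 hL0]
      nlinarith
    have hLt' : 4 / (L : ℝ) < t := by
      rw [div_lt_iff₀ hL0]
      have := (div_lt_iff₀ ht0).1 hLt
      linarith
    linarith
  calc μ.real (ZNodeEventB lam s x) = μ.real (ZNodeEventB lam s x ∩ {ω | ω ⊆ (zdGraph 2).edgeSet}) := heq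
    _ ≤ μ.real (⋃ w ∈ ilNet x s lam, ZGatedFourArm lam s x w (2 * lam) (s - 1)) :=
        measureReal_mono hcover (measure_ne_top _ _)
    _ ≤ ∑ w ∈ ilNet x s lam, μ.real (ZGatedFourArm lam s x w (2 * lam) (s - 1)) := measureReal_biUnion_finset_le _ _
    _ ≤ ∑ _w ∈ ilNet x s lam, C * ρ ^ (1 + ε) := Finset.sum_le_sum hterm
    _ = (ilNet x s lam).card * (C * ρ ^ (1 + ε)) := by rw [Finset.sum_const, nsmul_eq_mul]
    _ ≤ 4 * ((2 * s / lam + 1 : ℕ) : ℝ) * (C * ρ ^ (1 + ε)) := by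
        have hcard : ((ilNet x s lam).card : ℝ) ≤ 4 * ((2 * s / lam + 1 : ℕ) : ℝ) := by
          exact_mod_cast card_ilNet_le x s lam
        exact mul_le_mul_of_nonneg_right hcard (mul_nonneg hC.le (Real.rpow_nonneg hρ0 _))
    _ ≤ 48 * C * ρ ^ ε := NeckCoarseZ2.net_mul_rpow_le hC.le hlamR hsR hN hρ'
    _ ≤ 48 * C * (b / (48 * C)) := mul_le_mul_of_nonneg_left hρε (by positivity)
    _ = b := by field_simp

/-- **S12 from the absolute necklace bound for `𝔄` and the gated four-arm bound** (`ZFourStrandsPositive` is the tree's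
`zFourStrandsPositive_holds`): the corrected remaining inputs of stub S12 after this re-cut. -/
theorem neckHookupCoarseZ2_of_chainA_gated (hA : ZNodeAbsBoundChainA) (hG : ZGatedFourArmBound) : NeckHookupCoarseZ2 :=
  neckHookupCoarseZ2_of_chainInputs zFourStrandsPositive_holds hA (zNodeAbsBoundB_of_gatedFourArmBound hG)

end Summit.CriticalPhenomena.CardyFormulaZ2.Cruxes.NestingRigidity.PinchResampling

end
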